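import Summits.BirchSwinnertonDyer.Rank1Residual.Iwasawa.InertiaCohomologyPTorsionFinite
import Summits.BirchSwinnertonDyer.Rank1Residual.X2.ResidualDevissageModules
import Summits.BirchSwinnertonDyer.BirchSwinnertonDyer.Theorems.PrintCFramBottomClassIndexLawFiveLeEisensteinLocalLineDescent
import Literature.NumberTheory.GaloisRepresentations.InertiaCohomologyInvariantsBound
import Literature.NumberTheory.EllipticCurves.GreenbergVatsal2000.GreenbergSelmerGroups
import Literature.NumberTheory.EllipticCurves.ArchimedeanKummerImageMaximal
import Literature.NumberTheory.EllipticCurves.IsogenyMulProofs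
import Summits.BirchSwinnertonDyer.Rank1Residual.X11b.AnticyclotomicEulerChar
import HarnessLib

/-!
# Route `PrintCFram`, crux C2 `BottomClassIndexLawFiveLe` (stmt-BirchSwinnertonDyer-20372), line `eisenstein-resource-bdp-line`
# (registry v10), Stub H `stub_bottomResidualSelmer_trivial_of_bernoulliPair`: the places `v ∤ p` at which the inertia group
# has NO fixed vector are INVISIBLE to the bottom-layer residual Selmer groups — «no condition at `S`» = «unramified at `S`»

Cell `bsd-print-cfram`, width seat `bsd-line-cfram-p1-w7` (g0); helper `--supports stmt-BirchSwinnertonDyer-20372`.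
THEOREMS ONLY (0 definitions, 0 named facts, 0 instances, no `sorry`). HONEST FRAMING: nothing about BSD is proved; no stub
of the line is closed; BSD is not proved by any of this; no summit statement is proved by this seat.

## What (M1-anatomy §4 (ii) of `Cruxes/BottomClassIndexLawFiveLe/Lines/herbrand-regular-locus-M1-anatomy.md`, on the GALOIS side)

Stub H asserts the vanishing of the two residual Selmer groups
`datumStrictSelmer (κ.layerSubgroup 0) Φ.Sub p (bdpData …) S` / `… Φ.Quot …` over the Heegner field `K''` itself, where
`S = {v : W_{K''} bad at v, v ∤ p}` carries NO local condition (Greenberg–Vatsal's non-primitive `S^{Σ₀}`). The anatomy memo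
disposes of `S` on the class-field-theory side (§4 (ii): `(∏_{w∣v} U_w ⊗ ℤ_p)^{(θ)} = (Ind μ[p^∞])^{(θ)} = 0` because `θ` is
ramified at `v`). This file proves the same disposal on the Galois side, BEFORE any class field theory, for a GENERIC finite
discrete `p`-primary `Γ_K`-module `B` (any number field `K`, any `v ∤ p`):

* §1 `discreteH1_inertia_eq_zero_of_noFixed` — **`H¹(I_v, B) = 0`** when the local inertia group `I_v = res (absInertia K_v)`
  has no non-zero fixed vector on `B`: the tree's sharp bound `#H¹(I_F, B) ≤ #B^{I_F}` for `#B` prime to the residue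
  characteristic (`natCard_continuousCohomology_one_absInertia_le_natCard_invariants`, Serre *Local Fields* IV §2 + XIII §1 /
  Milne ADT I.2.9: tame quotient procyclic, wild inertia pro-`ℓ`), inflated along `absInertia K_v ↠ inertia v`
  (`Iwasawa.resH1Hom_injective_of_surjective`). (Local Euler-characteristic check: `#H¹(K_v, 𝔽_p(θ)) = #H⁰(θ)·#H⁰(θ⁻¹ω) = 1`
  for `θ|_{I_v} ≠ 1`.)
* §2 `unramifiedKer_eq_top_of_noFixed` — for every `H ≤ Γ_K` containing `I_v` (e.g. `H = ⊤ = κ.layerSubgroup 0`, or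
  `H = ker κ`, unramified outside `p`): Greenberg–Vatsal's unramified condition `unramifiedKer H B v` is ALL of `H¹(H, B)`.
* §3 `unramifiedOutside_eq_of_noFixed`, `datumSelmer_eq_of_noFixed`, **`datumStrictSelmer_eq_of_noFixed`** — S-ERASURE:
  if at every `v ∈ S₁ ∖ S₀` with `v ∤ p` the inertia group has no non-zero fixed vector on `B`, then the Selmer groups with
  «no condition at `S₁`» and «no condition at `S₀`» COINCIDE (`S₀ ⊆ S₁`; any Greenberg data `L` at `p`).
* §4 the reading for Stub H: `E` an elliptic curve over a number field `K`, `Φ` a `Γ_K`-stable subgroup of `E[p]`, `κ` any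
  `ℤ_p`-extension, any data `L`, any `S`: if at every `v ∈ S`, `v ∤ p`, some inertia element acts without non-zero fixed
  vector on `Φ` (resp. on `E[p]/Φ`), then `R^{S}(K, Φ) = R^{∅}(K, Φ)` (resp. for `E[p]/Φ`) at the bottom layer
  `κ.layerSubgroup 0` (`datumStrictSelmer_layerZero_sub_eq_empty`, `datumStrictSelmer_layerZero_quot_eq_empty`), and the
  convenient sufficient condition «some `σ ∈ I_v` acts as `−1` on `E[p]`» (`p` odd) for BOTH `Φ` and `E[p]/Φ`
  (`noFixed_sub_of_smul_eq_neg`, `noFixed_quot_of_smul_eq_neg`).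

CONSEQUENCE for the M1 proof of Stub H (T4): the class-field-theory modulus shrinks from `S_L ∪ {w ∣ 𝔭̄}` to `{w ∣ 𝔭̄}` —
no `S_L`-units and no `(Ind_{Δ_v}^Δ μ[p^∞])^{(θ)}` computation — once the class-level input «at a bad `v ∤ p` some inertia
element acts as `−1` on `W_{K''}[p]`» (quadratic twist of a curve with good reduction at `v`; companion file) is supplied.

References: [SerreLocalFields1979] Ch. IV §2 Cor. 1 and Cor. 3 of Prop. 7, Ch. XIII §1 Prop. 1; [MilneADT2006] I §2 Lemma 2.9;
[GreenbergVatsal2000] §2 pp. 16–17, 20, 23 (the groups `S^{Σ₀}`, Prop. (2.4)); [Greenberg1989] §1 p. 98.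
-/

set_option autoImplicit false
-- the summit namespace `Summit.BirchSwinnertonDyer.BirchSwinnertonDyer` repeats the problem name by design (D-0017)
set_option linter.dupNamespace false

noncomputable section

open scoped Classical

namespace Summit.BirchSwinnertonDyer.BirchSwinnertonDyer.Theorems.PrintCFram.BadPlacesInvisible

open CategoryTheory NumberField IsDedekindDomain Field
  Literature.NumberTheory.EllipticCurves Literature.NumberTheory.EllipticCurves.GreenbergSelmer
  Literature.NumberTheory.EllipticCurves.GreenbergVatsal2000
  Literature.NumberTheory.GaloisRepresentations
  Summit.BirchSwinnertonDyer.Rank1Residual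
  Summit.BirchSwinnertonDyer.Rank1Residual.X2.ResidualDevissageModules

universe u

/-! ## §1 `H¹(I_v, B) = 0` when the inertia group has no non-zero fixed vector on `B` (`v ∤ p`, `B` finite `p`-primary) -/

section Local

variable {K : Type u} [Field K] [NumberField K] {B : Type u} [AddCommGroup B]
  [DistribMulAction (absoluteGaloisGroup K) B] [TopologicalSpace B] [DiscreteTopology B]
  (p : ℕ) (v : HeightOneSpectrum (𝓞 K))

/-- **`H¹(I_v, B) = 0` for a finite discrete `p`-primary `Γ_K`-module `B` on which the inertia group at `v ∤ p` has no
non-zero fixed vector.** Here `I_v = inertia v = res (absInertia K_v) ≤ Γ_K` is GreenbergSelmer's inertia group for the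
chosen embedding. Proof: `#H¹(absInertia K_v, B) ≤ #B^{absInertia K_v}` (`natCard_continuousCohomology_one_absInertia_le_natCard_invariants`,
`#B = p^k` is prime to the residue characteristic `≠ p`), the invariants are `0` by hypothesis, and inflation along
`absInertia K_v ↠ inertia v` is injective (`Iwasawa.resH1Hom_injective_of_surjective`).
[cite: SerreLocalFields1979, Ch. XIII §1 Prop. 1 and Ch. IV §2 Cor. 1, Cor. 3 of Prop. 7] [cite: MilneADT2006, I §2 Lemma 2.9] -/
theorem discreteH1_inertia_eq_zero_of_noFixed [Fact p.Prime] [Finite B]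
    (hcard : ∃ k : ℕ, Nat.card B = p ^ k)
    (hcont : ∀ b : B, Continuous fun σ : absoluteGaloisGroup K ↦ σ • b)
    (hpv : (p : 𝓞 K) ∉ v.asIdeal)
    (hfix : ∀ b : B, (∀ σ ∈ inertia (K := K) v, σ • b = b) → b = 0)
    (x : discreteH1 (inertia (K := K) v) B) : x = 0 := by
  have hp : (p : ℕ).Prime := Fact.out
  -- the local action (through the chosen embedding), as a local instance of this proof only
  letI : DistribMulAction (absoluteGaloisGroup (v.adicCompletion K)) B :=
    DistribMulAction.compHom _ (absGaloisRestrict K (v.adicCompletion K)).toMonoidHom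
  -- `B` as a `ContinuousRep` of `Γ_{K_v}` over `ℤ`
  let ρ : ContinuousRep (absoluteGaloisGroup (v.adicCompletion K)) ℤ B :=
    { toRepresentation :=
        (discreteContRep (absoluteGaloisGroup (v.adicCompletion K)) B).toRepresentation
      continuous_smul := by
        refine continuous_prod_of_discrete_right.mpr fun b ↦ ?_
        change Continuous fun σ : absoluteGaloisGroup (v.adicCompletion K) ↦
          absGaloisRestrict K (v.adicCompletion K) σ • b
        exact (hcont b).comp (absGaloisRestrict K (v.adicCompletion K)).continuous_toFun }
  have hbridge : (ρ.restrict (Literature.NumberTheory.GaloisRepresentations.subgroupIncl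
      (absInertia (v.adicCompletion K)))).toTopRep =
      discreteTopRep (absInertia (v.adicCompletion K)) B :=
    rfl
  obtain ⟨k, hk⟩ := hcard
  have hℓ := ringChar_residueField_prime (F := v.adicCompletion K)
  have hne := v.ringChar_residueField_adicCompletion_ne hpv
  have hfin := (natCard_continuousCohomology_one_absInertia_le (v.adicCompletion K) ρ (by
      rw [hk]
      exact ((Nat.coprime_primes hp hℓ).2 (Ne.symm hne)).pow_left k)).1
  have hle := natCard_continuousCohomology_one_absInertia_le_natCard_invariants (v.adicCompletion K) ρ (by
      rw [hk]
      exact ((Nat.coprime_primes hp hℓ).2 (Ne.symm hne)).pow_left k)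
  rw [hbridge] at hfin hle
  -- the invariants are trivial: a vector fixed by `absInertia K_v` is fixed by `inertia v = res (absInertia K_v)`
  haveI hsub : Subsingleton {b : B // ∀ σ : absoluteGaloisGroup (v.adicCompletion K),
      σ ∈ absInertia (v.adicCompletion K) → ρ σ b = b} := by
    refine ⟨fun x y ↦ Subtype.ext ?_⟩
    have hx : x.1 = 0 := hfix x.1 fun τ hτ ↦ by
      obtain ⟨σ, hσ, rfl⟩ := Subgroup.mem_map.1 hτ
      exact x.2 σ hσ
    have hy : y.1 = 0 := hfix y.1 fun τ hτ ↦ by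
      obtain ⟨σ, hσ, rfl⟩ := Subgroup.mem_map.1 hτ
      exact y.2 σ hσ
    rw [hx, hy]
  haveI := hfin
  have hH1 : Subsingleton (discreteH1 (absInertia (v.adicCompletion K)) B) :=
    (Finite.card_le_one_iff_subsingleton).mp (hle.trans (Finite.card_le_one_iff_subsingleton.mpr hsub))
  -- inflation along `absInertia K_v ↠ inertia v`
  let θ : absInertia (v.adicCompletion K) →ₜ* inertia (K := K) v :=
    { toFun := fun x ↦ ⟨absGaloisRestrict K (v.adicCompletion K) x, Subgroup.mem_map_of_mem _ x.2⟩
      map_one' := Subtype.ext (by simp)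
      map_mul' := fun x y ↦ Subtype.ext (by simp)
      continuous_toFun :=
        ((absGaloisRestrict K (v.adicCompletion K)).continuous_toFun.comp
          continuous_subtype_val).subtype_mk _ }
  have hθ : Function.Surjective θ := by
    rintro ⟨y, hy⟩
    obtain ⟨x, hx, rfl⟩ := Subgroup.mem_map.1 hy
    exact ⟨⟨x, hx⟩, rfl⟩
  have hinj : Function.Injective
      ⇑(resH1Hom θ (AddMonoidHom.id B) (fun _ _ ↦ rfl) :
        discreteH1 (inertia (K := K) v) B →+ discreteH1 (absInertia (v.adicCompletion K)) B) :=
    Iwasawa.resH1Hom_injective_of_surjective θ hθ fun _ _ ↦ rfl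
  exact hinj (Subsingleton.elim _ _)

end Local

/-! ## §2 The unramified condition at such a place is vacuous: `unramifiedKer H B v = ⊤` -/

section Unramified

variable {K : Type u} [Field K] [NumberField K] {B : Type u} [AddCommGroup B]
  [DistribMulAction (absoluteGaloisGroup K) B] [TopologicalSpace B] [DiscreteTopology B]
  (p : ℕ) (v : HeightOneSpectrum (𝓞 K)) (H : Subgroup (absoluteGaloisGroup K))

/-- **`H¹(inertiaIn H v, B) = 0`** for every `H ≤ Γ_K` containing `I_v` (then `inertiaIn H v ≃ H ⊓ I_v = I_v`), under the
hypotheses of §1: the chain `H¹(inertiaIn H v, B) ↪ H¹(H ⊓ I_v, B) ↪ H¹(I_v, B) = 0`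
(`Iwasawa.exists_injective_discreteH1_inertiaIn_to_inf`; restriction along `I_v ≤ H ⊓ I_v` has the left inverse
`res_{H ⊓ I_v ≤ I_v}`). [cite: GreenbergVatsal2000, §2 p. 17] [cite: MilneADT2006, I §2 Lemma 2.9] -/
theorem discreteH1_inertiaIn_eq_zero_of_noFixed [Fact p.Prime] [Finite B]
    (hcard : ∃ k : ℕ, Nat.card B = p ^ k)
    (hcont : ∀ b : B, Continuous fun σ : absoluteGaloisGroup K ↦ σ • b)
    (hpv : (p : 𝓞 K) ∉ v.asIdeal)
    (hfix : ∀ b : B, (∀ σ ∈ inertia (K := K) v, σ • b = b) → b = 0)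
    (hH : inertia (K := K) v ≤ H)
    (x : discreteH1 (inertiaIn H v) B) : x = 0 := by
  obtain ⟨r₁, hr₁⟩ := Iwasawa.exists_injective_discreteH1_inertiaIn_to_inf (K := K) v H B
  have hle : inertia (K := K) v ≤ H ⊓ inertia (K := K) v := le_inf hH le_rfl
  let r₂ : subgroupH1 (H ⊓ inertia (K := K) v) B →+ subgroupH1 (inertia (K := K) v) B := resOfLe B hle
  have hr₂ : Function.Injective r₂ := by
    refine Function.LeftInverse.injective
      (g := resOfLe B (inf_le_right : H ⊓ inertia (K := K) v ≤ _)) fun c ↦ ?_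
    rw [← AddMonoidHom.comp_apply, Literature.NumberTheory.EllipticCurves.resOfLe_comp_holds,
      Literature.NumberTheory.EllipticCurves.resOfLe_refl_holds, AddMonoidHom.id_apply]
  have h0 : r₂ (r₁ x) = 0 := discreteH1_inertia_eq_zero_of_noFixed p v hcard hcont hpv hfix _
  have h1 : r₁ x = 0 := hr₂ (by rw [h0, map_zero])
  exact hr₁ (by rw [h1, map_zero])

/-- **The unramified condition at `v` is vacuous**: `unramifiedKer H B v = ⊤` — every class of `H¹(H, B)` restricts to
`0 ∈ H¹(inertiaIn H v, B) = 0` — for `H ⊇ I_v`, `v ∤ p`, and `B` finite discrete `p`-primary with no non-zero `I_v`-fixed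
vector. [cite: GreenbergVatsal2000, §2 p. 17] [cite: MilneADT2006, I §2 Lemma 2.9] -/
theorem unramifiedKer_eq_top_of_noFixed [Fact p.Prime] [Finite B]
    (hcard : ∃ k : ℕ, Nat.card B = p ^ k)
    (hcont : ∀ b : B, Continuous fun σ : absoluteGaloisGroup K ↦ σ • b)
    (hpv : (p : 𝓞 K) ∉ v.asIdeal)
    (hfix : ∀ b : B, (∀ σ ∈ inertia (K := K) v, σ • b = b) → b = 0)
    (hH : inertia (K := K) v ≤ H) :
    unramifiedKer H B v = ⊤ := by
  rw [eq_top_iff]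
  intro c _
  change c ∈ (resH1Hom (inertiaInToH H v) (AddMonoidHom.id B) fun _ _ ↦ rfl).ker
  rw [AddMonoidHom.mem_ker]
  exact discreteH1_inertiaIn_eq_zero_of_noFixed p v H hcard hcont hpv hfix hH _

end Unramified

/-! ## §3 S-erasure for Greenberg–Vatsal's non-primitive Selmer groups -/

section Erasure

variable {K : Type u} [Field K] [NumberField K] (H : Subgroup (absoluteGaloisGroup K)) [H.Normal]
  (B : Type u) [AddCommGroup B] [DistribMulAction (absoluteGaloisGroup K) B] [TopologicalSpace B] [DiscreteTopology B]
  (p : ℕ) {S₀ S₁ : Set (HeightOneSpectrum (𝓞 K))}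

/-- **S-erasure for `H¹(K_Σ/L, ·)`**: if `S₀ ⊆ S₁` and the unramified condition is vacuous (`unramifiedKer H B v = ⊤`) at
every `v ∈ S₁`, `v ∉ S₀`, `v ∤ p`, then `unramifiedOutside H B p S₁ = unramifiedOutside H B p S₀`.
[cite: GreenbergVatsal2000, §2 pp. 16, 23] -/
theorem unramifiedOutside_eq_of_unramifiedKer_eq_top (hS : S₀ ⊆ S₁)
    (h : ∀ v ∈ S₁, v ∉ S₀ → ((p : ℕ) : 𝓞 K) ∉ v.asIdeal → unramifiedKer H B v = ⊤) :
    unramifiedOutside H B p S₁ = unramifiedOutside H B p S₀ := by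
  ext c
  rw [mem_unramifiedOutside_iff, mem_unramifiedOutside_iff]
  constructor
  · intro hc v hv₀ hpv σ
    by_cases hv₁ : v ∈ S₁
    · rw [h v hv₁ hv₀ hpv]; exact AddSubgroup.mem_top _
    · exact hc v hv₁ hpv σ
  · intro hc v hv₁ hpv σ
    exact hc v (fun hv₀ ↦ hv₁ (hS hv₀)) hpv σ

/-- **S-erasure for `S^{S}_B(L)`** (Greenberg's inertia condition at `p`). [cite: GreenbergVatsal2000, §2 pp. 16–17, 20, 23] -/
theorem datumSelmer_eq_of_unramifiedKer_eq_top (L : Data K B p) (hS : S₀ ⊆ S₁)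
    (h : ∀ v ∈ S₁, v ∉ S₀ → ((p : ℕ) : 𝓞 K) ∉ v.asIdeal → unramifiedKer H B v = ⊤) :
    datumSelmer H B p L S₁ = datumSelmer H B p L S₀ := by
  rw [datumSelmer, datumSelmer, unramifiedOutside_eq_of_unramifiedKer_eq_top H B p hS h]

/-- **S-erasure for the STRICT group `S^{S,str}_B(L)`** (decomposition-group condition at `p` — the residual Selmer groups of
Stub H are of this kind, with `L = bdpData`). [cite: GreenbergVatsal2000, §2 pp. 15, 20, 23] -/
theorem datumStrictSelmer_eq_of_unramifiedKer_eq_top (L : Data K B p) (hS : S₀ ⊆ S₁)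
    (h : ∀ v ∈ S₁, v ∉ S₀ → ((p : ℕ) : 𝓞 K) ∉ v.asIdeal → unramifiedKer H B v = ⊤) :
    datumStrictSelmer H B p L S₁ = datumStrictSelmer H B p L S₀ := by
  rw [datumStrictSelmer, datumStrictSelmer, unramifiedOutside_eq_of_unramifiedKer_eq_top H B p hS h]

variable {H B p}

/-- **S-erasure from the no-fixed-vector hypothesis**: `S^{S₁,str}_B(L) = S^{S₀,str}_B(L)` for `S₀ ⊆ S₁` when, at every
`v ∈ S₁ ∖ S₀` with `v ∤ p`, `I_v ≤ H` and `I_v` has no non-zero fixed vector on the finite `p`-primary `B`.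
[cite: GreenbergVatsal2000, §2 pp. 15–17, 20, 23] [cite: MilneADT2006, I §2 Lemma 2.9] -/
theorem datumStrictSelmer_eq_of_noFixed [Fact p.Prime] [Finite B] (L : Data K B p) (hS : S₀ ⊆ S₁)
    (hcard : ∃ k : ℕ, Nat.card B = p ^ k)
    (hcont : ∀ b : B, Continuous fun σ : absoluteGaloisGroup K ↦ σ • b)
    (hH : ∀ v ∈ S₁, v ∉ S₀ → ((p : ℕ) : 𝓞 K) ∉ v.asIdeal → inertia (K := K) v ≤ H)
    (hfix : ∀ v ∈ S₁, v ∉ S₀ → ((p : ℕ) : 𝓞 K) ∉ v.asIdeal →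
      ∀ b : B, (∀ σ ∈ inertia (K := K) v, σ • b = b) → b = 0) :
    datumStrictSelmer H B p L S₁ = datumStrictSelmer H B p L S₀ :=
  datumStrictSelmer_eq_of_unramifiedKer_eq_top H B p L hS fun v hv₁ hv₀ hpv ↦
    unramifiedKer_eq_top_of_noFixed p v H hcard hcont hpv (hfix v hv₁ hv₀ hpv) (hH v hv₁ hv₀ hpv)

/-- The same for Greenberg's (inertia-condition) group `S^{S}_B(L)`. [cite: GreenbergVatsal2000, §2 pp. 16–17, 20, 23] -/
theorem datumSelmer_eq_of_noFixed [Fact p.Prime] [Finite B] (L : Data K B p) (hS : S₀ ⊆ S₁)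
    (hcard : ∃ k : ℕ, Nat.card B = p ^ k)
    (hcont : ∀ b : B, Continuous fun σ : absoluteGaloisGroup K ↦ σ • b)
    (hH : ∀ v ∈ S₁, v ∉ S₀ → ((p : ℕ) : 𝓞 K) ∉ v.asIdeal → inertia (K := K) v ≤ H)
    (hfix : ∀ v ∈ S₁, v ∉ S₀ → ((p : ℕ) : 𝓞 K) ∉ v.asIdeal →
      ∀ b : B, (∀ σ ∈ inertia (K := K) v, σ • b = b) → b = 0) :
    datumSelmer H B p L S₁ = datumSelmer H B p L S₀ :=
  datumSelmer_eq_of_unramifiedKer_eq_top H B p L hS fun v hv₁ hv₀ hpv ↦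
    unramifiedKer_eq_top_of_noFixed p v H hcard hcont hpv (hfix v hv₁ hv₀ hpv) (hH v hv₁ hv₀ hpv)

end Erasure

/-! ## §4 The reading for Stub H: stable subgroups of `E[p]`, bottom layer `κ.layerSubgroup 0 = ⊤` -/

section StubH

variable {K : Type} [Field K] [NumberField K] {p : ℕ} [Fact p.Prime]
  (E : WeierstrassCurve K) [E.IsElliptic] (κ : ZpExtension K p)
  (Φ : StableSubgroup (absoluteGaloisGroup K) (E.geomTorsion (p : ℤ)))

/-- In an additive group, an element killed by `2` and by an odd prime `p` is `0`. [folklore] -/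
theorem eq_zero_of_two_nsmul_of_prime_nsmul {A : Type*} [AddCommGroup A] (hp2 : p ≠ 2) {a : A}
    (h2 : 2 • a = 0) (hpa : p • a = 0) : a = 0 := by
  have hp : p.Prime := Fact.out
  obtain ⟨m, hm⟩ : Odd p := hp.odd_of_ne_two hp2
  have hodd : ∀ n : ℕ, (2 * n + 1) • a = a := by
    intro n
    induction n with
    | zero => rw [mul_zero, zero_add, one_nsmul]
    | succ n ih => rw [show 2 * (n + 1) + 1 = (2 * n + 1) + 2 by ring, add_nsmul, ih, h2, add_zero]
  rw [← hodd m, ← hm, hpa]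

omit [NumberField K] [Fact p.Prime] [E.IsElliptic] in
/-- `p • x = 0` on a stable subgroup of `E[p]`. [folklore] -/
theorem prime_nsmul_sub_eq_zero (x : Φ.Sub) : p • x = 0 :=
  Φ.incl_injective (by
    rw [map_nsmul, map_zero]
    have h := E.natAbs_nsmul_geomTorsion (Φ.incl x)
    rwa [Int.natAbs_natCast] at h)

omit [NumberField K] in
/-- `Φ` is finite of `p`-power order. [folklore] -/
theorem finite_sub_and_exists_natCard_eq_pow :
    Finite Φ.Sub ∧ ∃ k : ℕ, Nat.card Φ.Sub = p ^ k := by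
  haveI : Finite (E.geomTorsion (p : ℤ)) :=
    E.finite_geomTorsion (Int.natCast_ne_zero.mpr (Fact.out : p.Prime).ne_zero)
  haveI hf : Finite Φ.Sub := Finite.of_injective _ Φ.incl_injective
  exact ⟨hf, X11b.AcSelmer.exists_natCard_eq_prime_pow_of_forall fun x ↦
    ⟨1, by rw [pow_one]; exact prime_nsmul_sub_eq_zero E Φ x⟩⟩

omit [NumberField K] in
/-- `E[p]/Φ` is finite of `p`-power order. [folklore] -/
theorem finite_quot_and_exists_natCard_eq_pow :
    Finite Φ.Quot ∧ ∃ k : ℕ, Nat.card Φ.Quot = p ^ k := by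
  haveI : Finite (E.geomTorsion (p : ℤ)) :=
    E.finite_geomTorsion (Int.natCast_ne_zero.mpr (Fact.out : p.Prime).ne_zero)
  haveI hf : Finite Φ.Quot := Finite.of_surjective _ Φ.proj_surjective
  exact ⟨hf, X11b.AcSelmer.exists_natCard_eq_prime_pow_of_forall fun y ↦
    ⟨1, by rw [pow_one]; exact EisensteinLocalLineDescent.prime_smul_quot_eq_zero E Φ y⟩⟩

omit [NumberField K] [E.IsElliptic] in
/-- **If some `σ` acts as `−1` on `E[p]` (`p` odd), then `σ` has no non-zero fixed vector on the stable subgroup `Φ`.**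
[folklore] -/
theorem noFixed_sub_of_smul_eq_neg (hp2 : p ≠ 2) {σ : absoluteGaloisGroup K}
    (hσ : ∀ P : E.geomTorsion (p : ℤ), σ • P = -P) (x : Φ.Sub) (hx : σ • x = x) : x = 0 := by
  refine eq_zero_of_two_nsmul_of_prime_nsmul (p := p) hp2 ?_ (prime_nsmul_sub_eq_zero E Φ x)
  apply Φ.incl_injective
  rw [map_nsmul, map_zero, two_nsmul]
  have h := congrArg Φ.incl hx
  rw [Φ.incl_smul, hσ] at h
  have h' : Φ.incl x + Φ.incl x = -Φ.incl x + Φ.incl x := by rw [h]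
  rw [h', neg_add_cancel]

omit [NumberField K] [E.IsElliptic] in
/-- **If some `σ` acts as `−1` on `E[p]` (`p` odd), then `σ` has no non-zero fixed vector on the quotient `E[p]/Φ`.**
[folklore] -/
theorem noFixed_quot_of_smul_eq_neg (hp2 : p ≠ 2) {σ : absoluteGaloisGroup K}
    (hσ : ∀ P : E.geomTorsion (p : ℤ), σ • P = -P) (y : Φ.Quot) (hy : σ • y = y) : y = 0 := by
  refine eq_zero_of_two_nsmul_of_prime_nsmul (p := p) hp2 ?_ (EisensteinLocalLineDescent.prime_smul_quot_eq_zero E Φ y)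
  have hneg : σ • y = -y := (Φ.forall_smul_quot_eq_neg_iff σ).mpr (fun m ↦ by
    rw [hσ, neg_add_cancel]; exact zero_mem _) y
  rw [two_nsmul]
  nth_rw 1 [← hy]
  rw [hneg, neg_add_cancel]

/-- **S-erasure for the bottom-layer residual Selmer group of `Φ`** (the first conjunct of Stub H's conclusion, any data `L`
at `p`, e.g. `AcSelmer.bdpData Φ.Sub p 𝔭`): if at every `v ∈ S` with `v ∤ p` the inertia group `I_v` has no non-zero fixed
vector on `Φ`, then `R^{S}(K, Φ) = R^{∅}(K, Φ)` over `K` itself (`κ.layerSubgroup 0 = ⊤`).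
[cite: GreenbergVatsal2000, §2 pp. 15–17, 20, 23] [cite: MilneADT2006, I §2 Lemma 2.9] -/
theorem datumStrictSelmer_layerZero_sub_eq_empty (L : Data K Φ.Sub p) (S : Set (HeightOneSpectrum (𝓞 K)))
    (hfix : ∀ v ∈ S, ((p : ℕ) : 𝓞 K) ∉ v.asIdeal →
      ∀ x : Φ.Sub, (∀ σ ∈ inertia (K := K) v, σ • x = x) → x = 0) :
    datumStrictSelmer (κ.layerSubgroup 0) Φ.Sub p L S = datumStrictSelmer (κ.layerSubgroup 0) Φ.Sub p L ∅ := by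
  obtain ⟨hfin, hcard⟩ := finite_sub_and_exists_natCard_eq_pow E Φ
  haveI := hfin
  exact datumStrictSelmer_eq_of_noFixed L (Set.empty_subset S) hcard
    (Φ.continuous_smul_sub (CumulativeHeegnerInclusionAtThreeResidualDevissage.continuous_smul_geomTorsion E (p : ℤ)))
    (fun v _ _ _ ↦ by rw [ZpExtension.layerSubgroup_zero]; exact le_top)
    (fun v hv _ hpv ↦ hfix v hv hpv)

/-- **S-erasure for the bottom-layer residual Selmer group of `E[p]/Φ`** (the second conjunct of Stub H's conclusion).
[cite: GreenbergVatsal2000, §2 pp. 15–17, 20, 23] [cite: MilneADT2006, I §2 Lemma 2.9] -/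
theorem datumStrictSelmer_layerZero_quot_eq_empty (L : Data K Φ.Quot p) (S : Set (HeightOneSpectrum (𝓞 K)))
    (hfix : ∀ v ∈ S, ((p : ℕ) : 𝓞 K) ∉ v.asIdeal →
      ∀ y : Φ.Quot, (∀ σ ∈ inertia (K := K) v, σ • y = y) → y = 0) :
    datumStrictSelmer (κ.layerSubgroup 0) Φ.Quot p L S = datumStrictSelmer (κ.layerSubgroup 0) Φ.Quot p L ∅ := by
  obtain ⟨hfin, hcard⟩ := finite_quot_and_exists_natCard_eq_pow E Φ
  haveI := hfin
  exact datumStrictSelmer_eq_of_noFixed L (Set.empty_subset S) hcard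
    (Φ.continuous_smul_quot (CumulativeHeegnerInclusionAtThreeResidualDevissage.continuous_smul_geomTorsion E (p : ℤ)))
    (fun v _ _ _ ↦ by rw [ZpExtension.layerSubgroup_zero]; exact le_top)
    (fun v hv _ hpv ↦ hfix v hv hpv)

/-- **Both conjuncts at once, from sign elements.** If `p` is odd and at every `v ∈ S`, `v ∤ p`, some `σ ∈ I_v` acts as
`−1` on `E[p]` (on the CM-ramified class: `W_{K''} ≅ A ⊗ χ_d` with `A` good at `v` and `χ_d` ramified at `v`), then for
EVERY stable `Φ ≤ E[p]` and all data `L`, `L'`: `R^{S}(K, Φ) = R^{∅}(K, Φ)` and `R^{S}(K, E[p]/Φ) = R^{∅}(K, E[p]/Φ)` at the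
bottom layer. [cite: GreenbergVatsal2000, §2 pp. 15–17, 20, 23] [cite: MilneADT2006, I §2 Lemma 2.9] -/
theorem datumStrictSelmer_layerZero_eq_empty_of_smul_eq_neg (hp2 : p ≠ 2) (L : Data K Φ.Sub p) (L' : Data K Φ.Quot p)
    (S : Set (HeightOneSpectrum (𝓞 K)))
    (hS : ∀ v ∈ S, ((p : ℕ) : 𝓞 K) ∉ v.asIdeal →
      ∃ σ ∈ inertia (K := K) v, ∀ P : E.geomTorsion (p : ℤ), σ • P = -P) :
    datumStrictSelmer (κ.layerSubgroup 0) Φ.Sub p L S = datumStrictSelmer (κ.layerSubgroup 0) Φ.Sub p L ∅ ∧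
      datumStrictSelmer (κ.layerSubgroup 0) Φ.Quot p L' S = datumStrictSelmer (κ.layerSubgroup 0) Φ.Quot p L' ∅ := by
  refine ⟨datumStrictSelmer_layerZero_sub_eq_empty E κ Φ L S fun v hv hpv x hx ↦ ?_,
    datumStrictSelmer_layerZero_quot_eq_empty E κ Φ L' S fun v hv hpv y hy ↦ ?_⟩
  · obtain ⟨σ, hσI, hσ⟩ := hS v hv hpv
    exact noFixed_sub_of_smul_eq_neg E Φ hp2 hσ x (hx σ hσI)
  · obtain ⟨σ, hσI, hσ⟩ := hS v hv hpv
    exact noFixed_quot_of_smul_eq_neg E Φ hp2 hσ y (hy σ hσI)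

end StubH

end Summit.BirchSwinnertonDyer.BirchSwinnertonDyer.Theorems.PrintCFram.BadPlacesInvisible

end
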